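import Summits.BirchSwinnertonDyer.BirchSwinnertonDyer.Theorems.PrintCf2RamifiedOffTYZQFormForest
import HarnessLib

/-!
# Route `PrintCf2`, crux stmt-BirchSwinnertonDyer-20509 `RamifiedOffTYZOfFacts` — the Q-form identity (★): FOREST LAYER (F1b), cofactors
# (cell `bsd-print-cf2`, LEAD of 20509 g6, line `offtyz-v7`, cycle 7; kernel helpers `--supports stmt-BirchSwinnertonDyer-20509`)

Continuation of `PrintCf2RamifiedOffTYZQFormForest.lean` (crux workfile `Cruxes/RamifiedOffTYZOfFacts/Lines/offtyz_v7_QFormProof.md` §3–§5).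
Abstract arc weights `a` under the reciprocity law `a s t + a t s = y s * y t`, second vector `z`; `N = bigN a D z z z` is the symmetric form of
Monsky's matrix (note §1).

* §3 THE COFACTORS OF `N` as sums over ADMISSIBLE blocks only (`Σ_B y = 0`, `Σ_B z = 1`, i.e. `d_B ≡ 5 (mod 8)` for Monsky's data):
  `adj(N)_{(inr j)(inr j)} = Σ_{B ∋ j adm} κ_j(B) · det N(D∖B)` and `adj(N)_{(inl j)(inl j)} = Σ_{B ∋ j adm} q_z(B) · det N(D∖B)`
  (`adjugate_bigN_self_inr_inr_eq_sum_admissible`, `…inl_inl…`) — the shape of (★b) / of the `d₊`-formula (note §3: with `κ = diag adj N` and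
  the even-block dictionary `κ_t = blockRho` these ARE `kappaB = rhsB` and the `d₊`-formula; that bridge is the next file).
* §4 MIXED RECIPROCITY (note (5a)): for `Σ_X y = 0`, `Σ_{T ⊆ X} (Σ_T y) q_x(T) q_y(X∖T) = (Σ_X x) q_y(X)` (`sum_mul_qwt_mul_qwt_sdiff_eq`), from
  Smith's 5(b) identity `zblock_reciprocity` and the flatness of odd blocks.
* §5 EVEN BLOCKS: `unitize (lap a B ℓ) t` is the Laplacian of `B ∖ t` with roots `ℓ + a•t` (`unitize_lap_root`); the principal cofactor
  `adj(L_X + D_y)_{tt}` as a rooted forest sum (`adjugate_lap_self_eq_sum`) and its value `κ_t(X) + q_y(X)` for `Σ_X y = 0`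
  (`adjugate_lap_self_eq`, note (5b)) — the input of the pinned expansion (5c) of the next layer.
Pure linear algebra over `𝔽₂`; no `sorry`. BSD is not proved by any of this; no class is closed.

References: [cite: Smith2016CongruentDensity, §2 Prop. 2.4 and §2.2 case 5(b)]; [cite: Chaiken1982, §2 (all minors matrix tree theorem)];
[cite: ChebotarevAgaev2002, §3 Thm. 1–2 (matrix-tree / matrix-forest theorems)]; [cite: HeathBrown1994SelmerCongruentII, Appendix (Monsky), typescript p. 39 L27–L41].
-/

namespace Summit.BirchSwinnertonDyer.PrintCf2.QFormForest

open Matrix Finset Literature.LinearAlgebra.Matrix Literature.Combinatorics.Enumerative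
open Literature.NumberTheory.EllipticCurves.Smith2016

variable {V : Type*} [Fintype V] [LinearOrder V]

/-! ## §3. The cofactors of the symmetric Monsky form `N = bigN a D z z z` as sums over admissible blocks -/

/-- **Root-copy cofactor over admissible blocks** (the shape of (★b), note §3): under the reciprocity law on `D` with `Σ_D y = 0`,
`adj(N)_{(inr j)(inr j)} = Σ_{B ∋ j, Σ_B y = 0, Σ_B z = 1} κ_j(B) · det N(D∖B)` — in the tree's rooted pointed forest sum
(`adjugate_bigN_inr_inr`) the pointing weight `Σ_B z` selects `Σ_B z = 1`, and a pointed block with `Σ_B y = 1` leaves a complement of odd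
`y`-content, whose doubled determinant vanishes (§2). [cite: Chaiken1982, §2 (all minors matrix tree theorem)]
[cite: HeathBrown1994SelmerCongruentII, Appendix (Monsky), typescript p. 39 L27–L41] -/
theorem adjugate_bigN_self_inr_inr_eq_sum_admissible (a : V → V → ZMod 2) (y z : V → ZMod 2) {D : Finset V}
    (hrec : ∀ i ∈ D, ∀ j ∈ D, i ≠ j → a i j + a j i = y i * y j) (hyD : ∑ i ∈ D, y i = 0) {j : V} (hj : j ∈ D) :
    (bigN a D z z z).adjugate (Sum.inr j) (Sum.inr j) =
      ∑ B₀ ∈ ((D.erase j).powerset).filter (fun B₀ => ∑ i ∈ insert j B₀, y i = 0 ∧ ∑ i ∈ insert j B₀, z i = 1),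
        treeDet a (insert j B₀) j * (bigN a (D.erase j \ B₀) z z z).det := by
  rw [adjugate_bigN_inr_inr a hj, sum_filter]
  refine sum_congr rfl fun B₀ hB₀ => ?_
  rw [mem_powerset] at hB₀
  rw [← det_bigN_eq_setExp]
  have h01 : ∀ u : ZMod 2, u ≠ 1 → u = 0 := by decide
  by_cases hz : ∑ i ∈ insert j B₀, z i = 1
  · by_cases hy : ∑ i ∈ insert j B₀, y i = 0
    · rw [if_pos ⟨hy, hz⟩, hz, one_mul]
    · rw [if_neg (fun h => hy h.1)]
      -- the complement has odd `y`-content, hence determinant zero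
      have hy1 : ∑ i ∈ insert j B₀, y i = 1 := by
        have h2 : ∀ u : ZMod 2, u ≠ 0 → u = 1 := by decide
        exact h2 _ hy
      have hR : ∑ i ∈ D.erase j \ B₀, y i = 1 := by
        have h := sum_eq_sum_insert_add_sum_sdiff y hj hB₀
        rw [hyD, hy1] at h
        have h3 : ∀ u : ZMod 2, 0 = 1 + u → u = 1 := by decide
        exact h3 _ h
      have hRD : D.erase j \ B₀ ⊆ D := (sdiff_subset).trans (erase_subset j D)
      rw [det_bigN_self_eq_zero a y z _ (hrec_mono hRD hrec) (nonempty_of_sum_eq_one hR) (Or.inl hR), mul_zero]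
  · rw [if_neg (fun h => hz h.2), h01 _ hz, zero_mul, zero_mul]

/-- **Mark-copy cofactor over admissible blocks** (the shape of the `d₊`-formula, note §3): under the reciprocity law on `D` with
`Σ_D y = 0` and `Σ_D z = 1`, `adj(N)_{(inl j)(inl j)} = Σ_{B ∋ j, Σ_B y = 0, Σ_B z = 1} q_z(B) · det N(D∖B)` (a pointed block with
`Σ_B z = 0` or `Σ_B y = 1` leaves a complement with odd `z`- resp. `y`-content). [cite: Chaiken1982, §2 (all minors matrix tree theorem)]
[cite: HeathBrown1994SelmerCongruentII, Appendix (Monsky), typescript p. 39 L27–L41] -/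
theorem adjugate_bigN_self_inl_inl_eq_sum_admissible (a : V → V → ZMod 2) (y z : V → ZMod 2) {D : Finset V}
    (hrec : ∀ i ∈ D, ∀ j ∈ D, i ≠ j → a i j + a j i = y i * y j) (hyD : ∑ i ∈ D, y i = 0) (hzD : ∑ i ∈ D, z i = 1)
    {j : V} (hj : j ∈ D) :
    (bigN a D z z z).adjugate (Sum.inl j) (Sum.inl j) =
      ∑ B₀ ∈ ((D.erase j).powerset).filter (fun B₀ => ∑ i ∈ insert j B₀, y i = 0 ∧ ∑ i ∈ insert j B₀, z i = 1),
        qwt a z (insert j B₀) * (bigN a (D.erase j \ B₀) z z z).det := by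
  rw [adjugate_bigN_inl_inl a hj, sum_filter]
  refine sum_congr rfl fun B₀ hB₀ => ?_
  rw [mem_powerset] at hB₀
  rw [← det_bigN_eq_setExp]
  have hRD : D.erase j \ B₀ ⊆ D := (sdiff_subset).trans (erase_subset j D)
  have h2 : ∀ u : ZMod 2, u ≠ 0 → u = 1 := by decide
  have h3 : ∀ u : ZMod 2, 0 = 1 + u → u = 1 := by decide
  have h4 : ∀ u : ZMod 2, u ≠ 1 → u = 0 := by decide
  have h5 : ∀ u : ZMod 2, 1 = 0 + u → u = 1 := by decide
  by_cases hz : ∑ i ∈ insert j B₀, z i = 1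
  · by_cases hy : ∑ i ∈ insert j B₀, y i = 0
    · rw [if_pos ⟨hy, hz⟩]
    · rw [if_neg (fun h => hy h.1)]
      have hR : ∑ i ∈ D.erase j \ B₀, y i = 1 := by
        have h := sum_eq_sum_insert_add_sum_sdiff y hj hB₀
        rw [hyD, h2 _ hy] at h
        exact h3 _ h
      rw [det_bigN_self_eq_zero a y z _ (hrec_mono hRD hrec) (nonempty_of_sum_eq_one hR) (Or.inl hR), mul_zero]
  · rw [if_neg (fun h => hz h.2)]
    have hR : ∑ i ∈ D.erase j \ B₀, z i = 1 := by
      have h := sum_eq_sum_insert_add_sum_sdiff z hj hB₀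
      rw [hzD, h4 _ hz] at h
      exact h5 _ h
    rw [det_bigN_self_eq_zero a y z _ (hrec_mono hRD hrec) (nonempty_of_sum_eq_one hR) (Or.inr hR), mul_zero]

/-! ## §4. Mixed reciprocity -/

/-- **Mixed reciprocity** (note (5a)): under the reciprocity law on `X` with `Σ_X y = 0`, for every root-weight vector `x`,
`Σ_{T ⊆ X} (Σ_T y) · q_x(T) · q_y(X ∖ T) = (Σ_X x) · q_y(X)`. Only blocks `T` of odd `y`-content contribute, and those are flat
(§1: `q_x(T) = (Σ_T x) κ(T) = (Σ_T x) q_y(T)`), which turns the sum into Smith's 5(b) identity `zblock_reciprocity`.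
[cite: Smith2016CongruentDensity, §2.2 case 5(b) (source cnc2.tex l. 52–62)] -/
theorem sum_mul_qwt_mul_qwt_sdiff_eq (a : V → V → ZMod 2) (y x : V → ZMod 2) {X : Finset V}
    (hrec : ∀ i ∈ X, ∀ j ∈ X, i ≠ j → a i j + a j i = y i * y j) (hyX : ∑ i ∈ X, y i = 0) :
    ∑ T ∈ X.powerset, (∑ i ∈ T, y i) * qwt a x T * qwt a y (X \ T) = (∑ i ∈ X, x i) * qwt a y X := by
  have hz := zblock_reciprocity a y x (B := X) hrec
  rw [hyX, add_zero, mul_one] at hz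
  rw [hz]
  refine sum_congr rfl fun T hT => ?_
  rw [mem_powerset] at hT
  by_cases hyT : ∑ i ∈ T, y i = 1
  · obtain ⟨c, hc⟩ := nonempty_of_sum_eq_one hyT
    have hrecT := hrec_mono hT hrec
    have hcomp : ∑ i ∈ X \ T, y i = 1 := by
      have h := sum_sdiff hT (f := y)
      rw [hyT, hyX] at h
      have h2 : ∀ u : ZMod 2, u + 1 = 0 → u = 1 := by decide
      exact h2 _ h
    rw [qwt_eq_sum_mul_treeDet_of_odd a y x hrecT hyT hc, qwt_eq_sum_mul_treeDet_of_odd a y y hrecT hyT hc, hyT, hcomp]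
    ring
  · have h01 : ∀ u : ZMod 2, u ≠ 1 → u = 0 := by decide
    rw [h01 _ hyT]
    ring


/-! ## §5. The principal cofactors of an even block `N_X = lap a X y` (note (5b)) -/

omit [Fintype V] in
/-- Deleting `t ∈ B` from a Laplacian-type block WITH root weights: `unitize (lap a B ℓ) t` is the Laplacian-type matrix of `B ∖ t`
with root weights `ℓ + a•t` (the arcs into `t` become roots). [cite: ChebotarevAgaev2002, §3 Thm. 2 (matrix-forest theorem: delete row and column t)] -/
theorem unitize_lap_root (a : V → V → ZMod 2) {B : Finset V} {t : V} (ht : t ∈ B) (ℓ : V → ZMod 2) :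
    unitize (lap a B ℓ) t = lap a (B.erase t) (fun i => ℓ i + a i t) := by
  ext i j
  rw [unitize_apply, lap_apply, lap_apply]
  simp only [mem_erase, ne_eq]
  by_cases hj : j = t
  · subst hj; simp
  · by_cases hi : i = t
    · subst hi; simp [hj, Ne.symm hj]
    · simp only [hj, hi, if_false, not_false_eq_true, true_and]
      by_cases hiB : i ∈ B
      · by_cases hjB : j ∈ B
        · rw [if_pos (And.intro hiB hjB), if_pos (And.intro hiB hjB)]
          by_cases hij : i = j
          · rw [if_pos hij, if_pos hij, ← add_sum_erase (B.erase i) _ (mem_erase.mpr ⟨Ne.symm hi, ht⟩),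
              erase_right_comm, add_assoc]
          · rw [if_neg hij, if_neg hij]
        · have hij : i ≠ j := fun h => hjB (by rw [← h]; exact hiB)
          rw [if_neg (show ¬(i ∈ B ∧ j ∈ B) from fun h => hjB h.2), if_neg hij,
            if_neg (show ¬(i ∈ B ∧ j ∈ B) from fun h => hjB h.2)]
      · by_cases hij : i = j
        · subst hij
          rw [if_neg (show ¬(i ∈ B ∧ i ∈ B) from fun h => hiB h.1), if_pos rfl,
            if_neg (show ¬(i ∈ B ∧ i ∈ B) from fun h => hiB h.1)]
        · rw [if_neg (show ¬(i ∈ B ∧ j ∈ B) from fun h => hiB h.1), if_neg hij,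
            if_neg (show ¬(i ∈ B ∧ j ∈ B) from fun h => hiB h.1)]

/-- **The principal cofactor of `N_X = L_X + D_y` as a rooted forest sum** (no reciprocity needed):
`adj(N_X)_{tt} = Σ_{E ⊆ X∖t} κ_t({t} ∪ E) · setExp(q_y)(X∖t∖E)` — delete `t`, then split the roots `y + a•t` of the matrix-forest theorem
into the tree hooked at `t` and the `y`-rooted rest. [cite: ChebotarevAgaev2002, §3 Thm. 2 (matrix-forest theorem)] [cite: Chaiken1982, §2] -/
theorem adjugate_lap_self_eq_sum (a : V → V → ZMod 2) (y : V → ZMod 2) {X : Finset V} {t : V} (ht : t ∈ X) :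
    (lap a X y).adjugate t t =
      ∑ E ∈ (X.erase t).powerset, treeDet a (insert t E) t * setExp (qwt a y) (X.erase t \ E) := by
  rw [adjugate_apply, ← det_unitize, unitize_lap_root a ht y, det_lap_eq_setExp]
  have hq : qwt a (fun i => y i + a i t) = qwt a y + qwt a (fun i => a i t) := by
    funext B; rw [Pi.add_apply]; exact qwt_add a y (fun i => a i t) B
  rw [hq, setExp_add]
  refine sum_congr rfl fun E hE => ?_
  rw [mem_powerset] at hE
  have htE : t ∉ E := fun h => notMem_erase t X (hE h)
  rw [setExp_qwt_col_eq_treeDet (forestFormula_and_rooted E).1 a htE]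

omit [Fintype V] in
/-- Re-indexing the blocks containing `t`: `Σ_{T ⊆ X, t ∈ T} F(T) = Σ_{E ⊆ X∖t} F({t} ∪ E)`. [cite: Stanley1999EC2, Cor. 5.1.6 (exponential formula; elementary finite form)] -/
theorem sum_powerset_filter_mem_eq {R : Type*} [AddCommMonoid R] (F : Finset V → R) {X : Finset V} {t : V} (ht : t ∈ X) :
    ∑ T ∈ X.powerset.filter (fun T => t ∈ T), F T = ∑ E ∈ (X.erase t).powerset, F (insert t E) := by
  refine (sum_bij' (fun E _ => insert t E) (fun T _ => T.erase t) ?_ ?_ ?_ ?_ ?_).symm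
  · intro E hE
    rw [mem_powerset] at hE
    rw [mem_filter, mem_powerset]
    exact ⟨insert_subset ht (hE.trans (erase_subset t X)), mem_insert_self t E⟩
  · intro T hT
    rw [mem_filter, mem_powerset] at hT
    rw [mem_powerset]
    exact erase_subset_erase t hT.1
  · intro E hE
    rw [mem_powerset] at hE
    exact erase_insert fun h => notMem_erase t X (hE h)
  · intro T hT
    rw [mem_filter] at hT
    exact insert_erase hT.2
  · intro E _; rfl

/-- `q_{e_t}(T) = [t ∈ T] κ_t(T)`. [cite: ChebotarevAgaev2002, §3 Thm. 1 (matrix-tree theorem)] -/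
theorem qwt_single (a : V → V → ZMod 2) (T : Finset V) (t : V) :
    qwt a (Pi.single t 1) T = if t ∈ T then treeDet a T t else 0 := by
  rw [qwt]
  have h : ∀ s ∈ T, (Pi.single t (1 : ZMod 2) : V → ZMod 2) s * treeDet a T s = if s = t then treeDet a T s else 0 := by
    intro s _
    rw [Pi.single_apply]
    split_ifs <;> simp
  rw [sum_congr rfl h, sum_ite_eq']

/-- **`adj(N_X)_{tt} = κ_t(X) + q_y(X)` on an even block** (note (5b)): under the reciprocity law on `X` with `Σ_X y = 0` and `t ∈ X`.
The rooted forest sum of `adjugate_lap_self_eq_sum`, with `setExp(q_y)(R) = (Σ_R y) q_y(R)` for `R ≠ ∅` (`setExp_qwt_eq_sum_mul_qwt`),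
is `κ_t(X) + Σ_{t ∈ T ⊊ X} (Σ_T y) κ_t(T) q_y(X∖T)`, and the second sum is `q_y(X)` by mixed reciprocity at `x = e_t`.
[cite: Smith2016CongruentDensity, §2.2 case 5(b)] [cite: ChebotarevAgaev2002, §3 Thm. 2] -/
theorem adjugate_lap_self_eq (a : V → V → ZMod 2) (y : V → ZMod 2) {X : Finset V}
    (hrec : ∀ i ∈ X, ∀ j ∈ X, i ≠ j → a i j + a j i = y i * y j) (hyX : ∑ i ∈ X, y i = 0) {t : V} (ht : t ∈ X) :
    (lap a X y).adjugate t t = treeDet a X t + qwt a y X := by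
  rw [adjugate_lap_self_eq_sum a y ht]
  -- mixed reciprocity at `x = e_t`, re-indexed over the blocks containing `t`
  have hMR := sum_mul_qwt_mul_qwt_sdiff_eq a y (Pi.single t 1) hrec hyX
  rw [sum_pi_single', if_pos ht, one_mul] at hMR
  have hMR' : ∑ E ∈ (X.erase t).powerset,
      (∑ i ∈ insert t E, y i) * treeDet a (insert t E) t * qwt a y (X.erase t \ E) = qwt a y X := by
    rw [← hMR]
    have hvan : ∑ T ∈ X.powerset, (∑ i ∈ T, y i) * qwt a (Pi.single t 1) T * qwt a y (X \ T) =
        ∑ T ∈ X.powerset.filter (fun T => t ∈ T), (∑ i ∈ T, y i) * treeDet a T t * qwt a y (X \ T) := by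
      rw [sum_filter]
      refine sum_congr rfl fun T _ => ?_
      rw [qwt_single]
      split_ifs <;> simp
    rw [hvan, sum_powerset_filter_mem_eq _ ht]
    refine sum_congr rfl fun E _ => ?_
    rw [mem_insert_self t E |> fun _ => erase_sdiff_eq_sdiff_insert X E t]
  rw [← hMR']
  -- termwise: κ · setExp(q_y)(R) = κ·[R = ∅] + (Σ_{B} y) κ q_y(R)
  have hterm : ∀ E ∈ (X.erase t).powerset, treeDet a (insert t E) t * setExp (qwt a y) (X.erase t \ E) =
      (if E = X.erase t then treeDet a (insert t E) t else 0) +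
        (∑ i ∈ insert t E, y i) * treeDet a (insert t E) t * qwt a y (X.erase t \ E) := by
    intro E hE
    rw [mem_powerset] at hE
    by_cases hR : X.erase t \ E = ∅
    · have hEX : E = X.erase t := Subset.antisymm hE (sdiff_eq_empty_iff_subset.mp hR)
      rw [hR, setExp_empty, if_pos hEX, qwt]
      simp
    · have hEX : E ≠ X.erase t := fun h => hR (by rw [h, sdiff_self, bot_eq_empty])
      have hne : (X.erase t \ E).Nonempty := nonempty_iff_ne_empty.mpr hR
      have hRX : X.erase t \ E ⊆ X := (sdiff_subset).trans (erase_subset t X)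
      rw [setExp_qwt_eq_sum_mul_qwt a y hne (hrec_mono hRX hrec), if_neg hEX, zero_add]
      have hyR : ∑ i ∈ X.erase t \ E, y i = ∑ i ∈ insert t E, y i := by
        have h := sum_eq_sum_insert_add_sum_sdiff y ht hE
        rw [hyX] at h
        have h2 : ∀ u v : ZMod 2, 0 = u + v → v = u := by decide
        exact h2 _ _ h
      rw [hyR]
      ring
  rw [sum_congr rfl hterm, sum_add_distrib, sum_ite_eq' ((X.erase t).powerset) (X.erase t),
    if_pos (mem_powerset.mpr Subset.rfl), insert_erase ht]

end Summit.BirchSwinnertonDyer.PrintCf2.QFormForest
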